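import Literature.Probability.LatticeModels.LatticeInterface
import Literature.Probability.Percolation.TriDiscInterface
import HarnessLib

/-!
# Lattice interfaces, I′: the hexagonal exploration path is well defined (proofs)

Topic `Literature/Probability/LatticeModels`; companion of `LatticeInterface.lean`. This file
DISCHARGES the two named facts of that file about the exploration process of site percolation on
the triangular lattice `𝕋` with Dobrushin boundary conditions (Smirnov, *Critical percolation in
the plane*, long version (preprint Nov. 2001 = arXiv:0909.4499), §3, p. 11, just before
Theorem 3: "Consider now a domain `Ω` with two boundary points `a` and `b`. For any percolation
configuration there is a unique curve `γ_e.p.` along the edges of the dual hexagonal lattice,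
which goes from `a` to `b` separating the blue clusters intersecting the arc `ab` from the yellow
clusters intersecting the arc `ba`. This curve is called the exploration process";
Camia–Newman 2007, §2):

* `existsUnique_explorationPath_holds` — for admissible discrete Dobrushin data
  (`DiscreteDobrushin.IsAdmissible`) every site configuration has exactly one maximal
  exploration path (`IsExplorationPath`);
* `explorationWalk_isSome_holds` — hence `explorationWalk D ω` is defined.

## The argument (finite combinatorics of the step digraph; no planar topology)

Write `f ⟶ g` for `IsExplorationStep D ω f g` (the dual dart `f → g` crosses an edge of `Ω_δ`
with an open-or-arc-`A` site on its left and a closed-or-arc-`B` site on its right).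

1. *Darts around a face.* The darts of `𝕋` with left face `w` are the three anticlockwise darts
   `faceVertex w j → faceVertex w (j + 1)`, those with right face `w` are their reverses
   (`Literature.Probability.Percolation.exists_eq_faceVertex_of_adj`, `leftFace_faceVertex`
   of `TriDiscShelling.lean`, and `triEdgeFaces_symm`).
2. *Degrees.* Every face has at most one outgoing and at most one incoming step: two distinct
   clockwise darts of a triangle share a head–tail vertex, which would have to be both open and
   closed (`IsExplorationStep.out_unique`, `IsExplorationStep.in_unique`).
3. *Unbalanced faces are the outer `A`–`B` faces.* If a face has an outgoing step and no
   incoming one (a *source*) or vice versa (a *sink*), the crossed edge `{x, y}` is an `A`–`B`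
   edge of `Ω_δ` and the third vertex lies outside `Ω_δ`, i.e. the face is in
   `DiscreteDobrushin.abFaces`; this uses admissibility: the discrete arcs cover `∂Ω_δ`, are
   disjoint, and every `A`–`B` adjacency is an edge of `Ω_δ`
   (`DiscreteDobrushin.IsAdmissible.mem_abFaces_of_source`, `…mem_abFaces_of_sink`). Conversely
   each outer `A`–`B` face is a source or a sink (`…source_or_sink_of_mem_abFaces`).
4. *Longest step-path.* In a digraph with in-degrees `≤ 1` whose edges end in a finite set, from
   a vertex with a successor and no predecessor there is a self-avoiding step-path whose end has
   no successor (`exists_maximal_stepPath`; the faces meeting `Ω_δ` are finitely many by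
   `triMeshDomain_finite_holds`).
5. *Existence:* an outer `A`–`B` face (there are two) is a source, or a sink from which the
   backward search (4) reaches a source; the forward search (4) from a source is an exploration
   path. *Uniqueness:* the start of an exploration path is a source and its end a sink, both
   outer `A`–`B` faces, of which there are exactly two; so two exploration paths start at the
   same face, and then coincide since out-degrees are `≤ 1` and both stop exactly at out-degree
   `0` (`stepPath_unique`).

## References

* S. Smirnov, *Critical percolation in the plane: conformal invariance, Cardy's formula, scaling
  limits*, C. R. Acad. Sci. Paris Sér. I 333 (2001) 239–244; long version arXiv:0909.4499, §3.
* F. Camia, C. M. Newman, *Critical percolation exploration path and SLE₆: a proof of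
  convergence*, Probab. Theory Related Fields 139 (2007), §2.

## Mathlib / tree

Mathlib: `SimpleGraph.Walk` (`IsPath`, `concat`, `darts`, `support`, `map_snd_darts`,
`exists_eq_cons_of_ne`), `Nat.findGreatest`, `Set.ncard` (`Set.eq_of_subset_of_ncard_le`).
Tree: `faceVertex`, `leftFace`, `facesAt`, `adj_faceVertex_succ` (`TriDiscreteDomain.lean`,
`TriDiscShelling.lean`, `TriDiscInterface.lean`), `triEdgeFaces_symm_holds`,
`hexGraph_adj_triEdgeFaces_holds`, `triMeshDomain_finite_holds` (`TriangularLatticeProofs.lean`);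
the elementary face facts `touchesBothArcs_*` are discharged in `LatticeInterfaceProofs.lean`.
No new definitions.
-/

namespace Literature.Probability.LatticeModels

open SimpleGraph
open Literature.Probability.Percolation (faceVertex faceVertex_mem leftFace leftFace_faceVertex
  leftFace_eq_triEdgeFaces_fst exists_eq_faceVertex_of_adj mem_hexFaceVertices_iff_faceVertex
  facesAt mem_facesAt)
open Literature.Probability.Percolation.TriMarkedDomain (fin3_add_one_add_one fin3_add_two_add_one
  adj_faceVertex_succ)

noncomputable section

/-! ### Step-paths in a digraph with in-degrees at most one -/

section StepPath

variable {V : Type*} {G : SimpleGraph V}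

/-- In a self-avoiding walk no dart starts at the final vertex. [folklore] -/
theorem dart_fst_ne_of_isPath {a b : V} {w : G.Walk a b} (hw : w.IsPath) {d : G.Dart}
    (hd : d ∈ w.darts) : d.fst ≠ b := by
  intro hdb
  have hmem : d.symm ∈ w.reverse.darts := by
    rw [Walk.darts_reverse]
    exact List.mem_reverse.2 (List.mem_map.2 ⟨d, hd, rfl⟩)
  have htail : b ∈ w.reverse.support.tail := by
    rw [← Walk.map_snd_darts]
    exact List.mem_map.2 ⟨d.symm, hmem, hdb⟩
  have hnd := hw.reverse.support_nodup
  rw [← Walk.cons_tail_support] at hnd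
  exact (List.nodup_cons.1 hnd).1 htail

/-- **Longest step-path.** Let `S` be a relation contained in the adjacency of `G` with
in-degrees at most one (`S a c → S b c → a = b`) whose targets lie in a finite set. From a vertex
`a` without `S`-predecessor and with an `S`-successor there is a self-avoiding walk all of whose
darts are `S`-steps and whose final vertex has no `S`-successor (a longest such walk: it could
otherwise be extended, the new vertex being off the walk because its unique predecessor is the
current end). [folklore] -/
theorem exists_maximal_stepPath (S : V → V → Prop) (hSG : ∀ ⦃a b⦄, S a b → G.Adj a b)
    (hin : ∀ ⦃a b c⦄, S a c → S b c → a = b) {F : Set V} (hF : F.Finite)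
    (hSF : ∀ ⦃a b⦄, S a b → b ∈ F) {a a₁ : V} (ha : ∀ c, ¬ S c a) (ha₁ : S a a₁) :
    ∃ (b : V) (w : G.Walk a b),
      w.IsPath ∧ (∀ d ∈ w.darts, S d.fst d.snd) ∧ ∀ c, ¬ S b c := by
  classical
  -- `P n`: there is a self-avoiding `S`-walk of length `n` from `a`
  let P : ℕ → Prop := fun n =>
    ∃ (b : V) (w : G.Walk a b), w.IsPath ∧ (∀ d ∈ w.darts, S d.fst d.snd) ∧ w.length = n
  have hP0 : P 0 := ⟨a, Walk.nil, Walk.IsPath.nil, by simp, rfl⟩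
  have hbound : ∀ n, P n → n ≤ hF.toFinset.card := by
    rintro n ⟨b, w, hw, hS, rfl⟩
    have hnd : w.support.tail.Nodup := by
      have h := hw.support_nodup
      rw [← Walk.cons_tail_support] at h
      exact (List.nodup_cons.1 h).2
    have hsub : w.support.tail.toFinset ⊆ hF.toFinset := by
      intro x hx
      rw [List.mem_toFinset, ← Walk.map_snd_darts] at hx
      obtain ⟨d, hd, rfl⟩ := List.mem_map.1 hx
      exact hF.mem_toFinset.2 (hSF (hS d hd))
    have hlen : w.support.tail.length = w.length := by simp [Walk.length_support]
    calc w.length = w.support.tail.toFinset.card := by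
          rw [List.toFinset_card_of_nodup hnd, hlen]
      _ ≤ hF.toFinset.card := Finset.card_le_card hsub
  -- a longest one
  have hPN : P (Nat.findGreatest P hF.toFinset.card) := Nat.findGreatest_spec (Nat.zero_le _) hP0
  have hmax : ∀ m, P m → m ≤ Nat.findGreatest P hF.toFinset.card := fun m hm =>
    Nat.le_findGreatest (hbound m hm) hm
  obtain ⟨b, w, hw, hS, hlen⟩ := hPN
  refine ⟨b, w, hw, hS, fun c hc => ?_⟩
  -- otherwise extend by the step `b ⟶ c`
  have hcs : c ∉ w.support := by
    intro hcmem
    rw [← Walk.cons_tail_support, List.mem_cons] at hcmem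
    rcases hcmem with rfl | hct
    · exact ha b hc
    · rw [← Walk.map_snd_darts] at hct
      obtain ⟨d, hd, hdc⟩ := List.mem_map.1 hct
      have hSd : S d.fst c := by rw [← hdc]; exact hS d hd
      exact dart_fst_ne_of_isPath hw hd (hin hSd hc)
  have hP' : P (Nat.findGreatest P hF.toFinset.card + 1) := by
    refine ⟨c, w.concat (hSG hc), hw.concat hcs (hSG hc), fun d hd => ?_, by
      rw [Walk.length_concat, hlen]⟩
    rw [Walk.darts_concat, List.concat_eq_append, List.mem_append, List.mem_singleton] at hd
    rcases hd with hd | rfl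
    · exact hS d hd
    · exact hc
  have := hmax _ hP'
  omega

/-- **Determinism.** If out-degrees of `S` are at most one, two `S`-walks from the same vertex
whose final vertices have no `S`-successor coincide (with their endpoints). [folklore] -/
theorem stepPath_unique (S : V → V → Prop) (hout : ∀ ⦃a b c⦄, S a b → S a c → b = c)
    {a b₁ : V} (w₁ : G.Walk a b₁) :
    ∀ {b₂ : V} (w₂ : G.Walk a b₂), (∀ d ∈ w₁.darts, S d.fst d.snd) →
      (∀ d ∈ w₂.darts, S d.fst d.snd) → (∀ c, ¬ S b₁ c) → (∀ c, ¬ S b₂ c) →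
      (⟨b₁, w₁⟩ : Σ b : V, G.Walk a b) = ⟨b₂, w₂⟩ := by
  induction w₁ with
  | nil =>
    intro b₂ w₂ _ hS₂ hend₁ _
    cases w₂ with
    | nil => rfl
    | @cons _ v' _ h₂ q => exact (hend₁ v' (hS₂ ⟨(_, v'), h₂⟩ (by simp))).elim
  | @cons u v x h₁ p ih =>
    intro b₂ w₂ hS₁ hS₂ hend₁ hend₂
    cases w₂ with
    | nil => exact (hend₂ v (hS₁ ⟨(u, v), h₁⟩ (by simp))).elim
    | @cons _ v' _ h₂ q =>
      have hv : v = v' :=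
        hout (hS₁ ⟨(u, v), h₁⟩ (by simp)) (hS₂ ⟨(u, v'), h₂⟩ (by simp))
      subst hv
      have key := ih q (fun d hd => hS₁ d (by simp [hd])) (fun d hd => hS₂ d (by simp [hd]))
        hend₁ hend₂
      obtain ⟨rfl, hpq⟩ := Sigma.mk.inj_iff.1 key
      have hpq' := eq_of_heq hpq
      subst hpq'
      rfl

end StepPath

/-! ### The darts of `𝕋` bordering a face -/

/-- The left face of a dart is `leftFace` of `TriDiscShelling.lean`. [folklore] -/
theorem triEdgeFaces_fst (e : triGraph.Dart) : (triEdgeFaces e).1 = leftFace e.fst e.snd :=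
  (leftFace_eq_triEdgeFaces_fst e.adj).symm

/-- The right face of a dart is the left face of the reversed dart. [folklore] -/
theorem triEdgeFaces_snd (e : triGraph.Dart) : (triEdgeFaces e).2 = leftFace e.snd e.fst := by
  have h : (triEdgeFaces e).2 = (triEdgeFaces e.symm).1 := by
    rw [triEdgeFaces_symm_holds e]
    rfl
  rw [h, triEdgeFaces_fst]
  rfl

/-- **A dart with left face `w` is an anticlockwise dart of `w`.** [folklore] -/
theorem exists_eq_faceVertex_of_triEdgeFaces_fst {e : triGraph.Dart} {w : HexVertex}
    (h : (triEdgeFaces e).1 = w) :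
    ∃ j : Fin 3, e.fst = faceVertex w j ∧ e.snd = faceVertex w (j + 1) := by
  rw [triEdgeFaces_fst] at h
  subst h
  exact exists_eq_faceVertex_of_adj e.adj

/-- **A dart with right face `w` is a clockwise dart of `w`.** [folklore] -/
theorem exists_eq_faceVertex_of_triEdgeFaces_snd {e : triGraph.Dart} {w : HexVertex}
    (h : (triEdgeFaces e).2 = w) :
    ∃ j : Fin 3, e.snd = faceVertex w j ∧ e.fst = faceVertex w (j + 1) := by
  rw [triEdgeFaces_snd] at h
  subst h
  exact exists_eq_faceVertex_of_adj e.adj.symm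

/-- The left face of the anticlockwise dart `faceVertex w j → faceVertex w (j + 1)` is `w`.
[folklore] -/
theorem triEdgeFaces_fst_faceVertex (w : HexVertex) (j : Fin 3) :
    (triEdgeFaces ⟨(faceVertex w j, faceVertex w (j + 1)), adj_faceVertex_succ w j⟩).1
      = w := by
  rw [triEdgeFaces_fst]
  exact leftFace_faceVertex w j

/-- The right face of the clockwise dart `faceVertex w (j + 1) → faceVertex w j` is `w`.
[folklore] -/
theorem triEdgeFaces_snd_faceVertex (w : HexVertex) (j : Fin 3) :
    (triEdgeFaces ⟨(faceVertex w (j + 1), faceVertex w j),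
      (adj_faceVertex_succ w j).symm⟩).2 = w := by
  rw [triEdgeFaces_snd]
  exact leftFace_faceVertex w j

/-- Index arithmetic in `Fin 3`: two indices are equal or differ by `1` or `2`. [folklore] -/
theorem fin3_trichotomy (j j' : Fin 3) : j' = j ∨ j' = j + 1 ∨ j' = j + 2 := by
  fin_cases j <;> fin_cases j' <;> decide

/-- If three consecutive labelled vertices of a face lie in a set, all its vertices do. [folklore] -/
theorem hexFaceVertices_subset_of_faceVertex_mem {w : HexVertex} {T : Set (Site 2)} (j : Fin 3)
    (h0 : faceVertex w j ∈ T) (h1 : faceVertex w (j + 1) ∈ T)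
    (h2 : faceVertex w (j + 2) ∈ T) : (↑(hexFaceVertices w) : Set (Site 2)) ⊆ T := by
  intro z hz
  obtain ⟨i, rfl⟩ := mem_hexFaceVertices_iff_faceVertex.1 (Finset.mem_coe.1 hz)
  rcases fin3_trichotomy j i with rfl | rfl | rfl
  · exact h0
  · exact h1
  · exact h2

/-! ### Exploration steps: degrees -/

/-- An exploration step is a step of the hexagonal lattice. [cite: Smirnov2001, long version §3 p. 11 before Theorem 3] -/
theorem IsExplorationStep.adj {D : DiscreteDobrushin} {ω : Percolation.SiteConfig (Site 2)}
    {f g : HexVertex} (h : IsExplorationStep D ω f g) : hexGraph.Adj f g := by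
  obtain ⟨e, he, -, -, -⟩ := h
  have h' := hexGraph_adj_triEdgeFaces_holds e
  rw [he] at h'
  exact h'.symm

/-- **Out-degrees of the step digraph are at most one**: the step out of a face is unique (two
distinct clockwise darts of a triangle share a vertex which is the open tail of one and the
closed head of the other). [cite: Smirnov2001, long version §3 p. 11 before Theorem 3] -/
theorem IsExplorationStep.out_unique {D : DiscreteDobrushin} {ω : Percolation.SiteConfig (Site 2)}
    {f g g' : HexVertex} (h : IsExplorationStep D ω f g) (h' : IsExplorationStep D ω f g') :
    g = g' := by
  obtain ⟨e, he, -, hx, hy⟩ := h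
  obtain ⟨e', he', -, hx', hy'⟩ := h'
  have hf : (triEdgeFaces e).2 = f := by rw [he]
  have hf' : (triEdgeFaces e').2 = f := by rw [he']
  obtain ⟨j, hj, hj1⟩ := exists_eq_faceVertex_of_triEdgeFaces_snd hf
  obtain ⟨j', hj', hj1'⟩ := exists_eq_faceVertex_of_triEdgeFaces_snd hf'
  rcases fin3_trichotomy j j' with rfl | rfl | rfl
  · have hee : e = e' := by
      ext
      · rw [hj1, hj1']
      · rw [hj, hj']
    subst hee
    have := he.symm.trans he'
    simpa using this
  · rw [hj', ← hj1] at hy'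
    exact (hy' hx).elim
  · rw [hj1', fin3_add_two_add_one, ← hj] at hx'
    exact (hy hx').elim

/-- **In-degrees of the step digraph are at most one**: the step into a face is unique.
[cite: Smirnov2001, long version §3 p. 11 before Theorem 3] -/
theorem IsExplorationStep.in_unique {D : DiscreteDobrushin} {ω : Percolation.SiteConfig (Site 2)}
    {f h₁ h₂ : HexVertex} (h : IsExplorationStep D ω h₁ f) (h' : IsExplorationStep D ω h₂ f) :
    h₁ = h₂ := by
  obtain ⟨e, he, -, hx, hy⟩ := h
  obtain ⟨e', he', -, hx', hy'⟩ := h'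
  have hf : (triEdgeFaces e).1 = f := by rw [he]
  have hf' : (triEdgeFaces e').1 = f := by rw [he']
  obtain ⟨j, hj, hj1⟩ := exists_eq_faceVertex_of_triEdgeFaces_fst hf
  obtain ⟨j', hj', hj1'⟩ := exists_eq_faceVertex_of_triEdgeFaces_fst hf'
  rcases fin3_trichotomy j j' with rfl | rfl | rfl
  · have hee : e = e' := by
      ext
      · rw [hj, hj']
      · rw [hj1, hj1']
    subst hee
    have := he.symm.trans he'
    simpa using this
  · rw [hj', ← hj1] at hx'
    exact (hy hx').elim
  · rw [hj1', fin3_add_two_add_one, ← hj] at hy'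
    exact (hy' hx).elim

/-- Both faces of an exploration step meet `Ω_δ` (at the tail of the crossed dart).
[cite: Smirnov2001, long version §3 p. 11 before Theorem 3] -/
theorem IsExplorationStep.mem_stepFaces {D : DiscreteDobrushin}
    {ω : Percolation.SiteConfig (Site 2)} {f g : HexVertex} (h : IsExplorationStep D ω f g) :
    f ∈ {f : HexVertex | ∃ x ∈ hexFaceVertices f, x ∈ triMeshDomain D.Ω D.δ} ∧
      g ∈ {f : HexVertex | ∃ x ∈ hexFaceVertices f, x ∈ triMeshDomain D.Ω D.δ} := by
  obtain ⟨e, he, hadj, -, -⟩ := h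
  have hxd : e.fst ∈ triMeshDomain D.Ω D.δ := (triDiscreteDomainGraph_adj_iff.1 hadj).2.1
  have hf : (triEdgeFaces e).2 = f := by rw [he]
  have hg : (triEdgeFaces e).1 = g := by rw [he]
  obtain ⟨j, -, hj1⟩ := exists_eq_faceVertex_of_triEdgeFaces_snd hf
  obtain ⟨i, hi, -⟩ := exists_eq_faceVertex_of_triEdgeFaces_fst hg
  refine ⟨⟨e.fst, ?_, hxd⟩, ⟨e.fst, ?_, hxd⟩⟩
  · rw [hj1]; exact faceVertex_mem f _
  · rw [hi]; exact faceVertex_mem g _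

/-! ### Exploration steps and the boundary arcs -/

namespace DiscreteDobrushin.IsAdmissible

variable {D : DiscreteDobrushin}

/-- Arc-`B` sites are closed under the boundary condition (the arcs being disjoint).
[cite: Smirnov2001, long version §3 p. 11 before Theorem 3] -/
theorem notMem_bcConfig (hD : D.IsAdmissible) {ω : Percolation.SiteConfig (Site 2)} {x : Site 2}
    (hx : x ∈ D.triArcB) : x ∉ D.bcConfig ω :=
  D.notMem_bcConfig_of_mem_triArcB hx (fun hA => Set.disjoint_left.1 hD.disjoint hA hx)

/-- An open boundary site lies on the discrete arc of `A`. [cite: Smirnov2001, long version §3 p. 11 before Theorem 3] -/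
theorem mem_triArcA_of_mem_bcConfig (hD : D.IsAdmissible) {ω : Percolation.SiteConfig (Site 2)}
    {x : Site 2} (hb : x ∈ triMeshBoundary D.Ω D.δ) (hx : x ∈ D.bcConfig ω) : x ∈ D.triArcA := by
  rcases hD.triMeshBoundary_subset hb with hA | hB
  · exact hA
  · exact (hD.notMem_bcConfig hB hx).elim

/-- A closed boundary site lies on the discrete arc of `B`. [cite: Smirnov2001, long version §3 p. 11 before Theorem 3] -/
theorem mem_triArcB_of_notMem_bcConfig (hD : D.IsAdmissible) {ω : Percolation.SiteConfig (Site 2)}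
    {x : Site 2} (hb : x ∈ triMeshBoundary D.Ω D.δ) (hx : x ∉ D.bcConfig ω) : x ∈ D.triArcB := by
  rcases hD.triMeshBoundary_subset hb with hA | hB
  · exact (hx (D.mem_bcConfig_of_mem_triArcA hA)).elim
  · exact hB

/-- **The boundary lemma.** Let the dart `x → y` of `Ω_δ` have `x` open and `y` closed (boundary
condition imposed), and let `z` be a common `𝕋`-neighbour of `x` and `y` such that neither
`x → z` (with `z` closed) nor `z → y` (with `z` open) is such a dart of `Ω_δ`. Then `x` lies on
the discrete arc of `A`, `y` on that of `B`, and `z ∉ Ω_δ`: by admissibility a boundary site is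
on `A` iff open, and an `A`–`B` adjacency is always an edge of `Ω_δ`.
[cite: Smirnov2001, long version §3 p. 11 before Theorem 3] -/
theorem mem_abDarts_of_blocked (hD : D.IsAdmissible) {ω : Percolation.SiteConfig (Site 2)}
    {e : triGraph.Dart} {z : Site 2} (he : (triDiscreteDomainGraph D.Ω D.δ).Adj e.fst e.snd)
    (hx : e.fst ∈ D.bcConfig ω) (hy : e.snd ∉ D.bcConfig ω) (hxz : triGraph.Adj e.fst z)
    (hzy : triGraph.Adj z e.snd)
    (H1 : ¬ ((triDiscreteDomainGraph D.Ω D.δ).Adj e.fst z ∧ z ∉ D.bcConfig ω))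
    (H2 : ¬ ((triDiscreteDomainGraph D.Ω D.δ).Adj z e.snd ∧ z ∈ D.bcConfig ω)) :
    e ∈ D.abDarts ∧ z ∉ triMeshDomain D.Ω D.δ := by
  have hxd : e.fst ∈ triMeshDomain D.Ω D.δ := (triDiscreteDomainGraph_adj_iff.1 he).2.1
  have hyd : e.snd ∈ triMeshDomain D.Ω D.δ := (triDiscreteDomainGraph_adj_iff.1 he).2.2
  -- boundary membership from a missing edge
  have bdry : ∀ {u v : Site 2}, u ∈ triMeshDomain D.Ω D.δ → triGraph.Adj u v →
      ¬ (triDiscreteDomainGraph D.Ω D.δ).Adj u v → u ∈ triMeshBoundary D.Ω D.δ :=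
    fun hu huv h => ⟨hu, _, huv, h⟩
  -- Claim A: `x → z` is not an edge of `Ω_δ`
  have hA : ¬ (triDiscreteDomainGraph D.Ω D.δ).Adj e.fst z := by
    intro hxz'
    have hzb : z ∈ D.bcConfig ω := by
      by_contra hzb
      exact H1 ⟨hxz', hzb⟩
    have hzy' : ¬ (triDiscreteDomainGraph D.Ω D.δ).Adj z e.snd := fun h => H2 ⟨h, hzb⟩
    have hzd : z ∈ triMeshDomain D.Ω D.δ := (triDiscreteDomainGraph_adj_iff.1 hxz').2.2
    have hzA : z ∈ D.triArcA := hD.mem_triArcA_of_mem_bcConfig (bdry hzd hzy hzy') hzb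
    have hyB : e.snd ∈ D.triArcB :=
      hD.mem_triArcB_of_notMem_bcConfig (bdry hyd hzy.symm fun h => hzy' h.symm) hy
    exact hzy' (hD.adj_of_mem_arcs z hzA e.snd hyB hzy)
  -- Claim B: `z → y` is not an edge of `Ω_δ`
  have hB : ¬ (triDiscreteDomainGraph D.Ω D.δ).Adj z e.snd := by
    intro hzy'
    have hzb : z ∉ D.bcConfig ω := fun hzb => H2 ⟨hzy', hzb⟩
    have hzd : z ∈ triMeshDomain D.Ω D.δ := (triDiscreteDomainGraph_adj_iff.1 hzy').2.1
    have hzB : z ∈ D.triArcB :=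
      hD.mem_triArcB_of_notMem_bcConfig (bdry hzd hxz.symm fun h => hA h.symm) hzb
    have hxA : e.fst ∈ D.triArcA := hD.mem_triArcA_of_mem_bcConfig (bdry hxd hxz hA) hx
    exact hA (hD.adj_of_mem_arcs e.fst hxA z hzB hxz)
  have hxA : e.fst ∈ D.triArcA := hD.mem_triArcA_of_mem_bcConfig (bdry hxd hxz hA) hx
  have hyB : e.snd ∈ D.triArcB :=
    hD.mem_triArcB_of_notMem_bcConfig (bdry hyd hzy.symm fun h => hB h.symm) hy
  refine ⟨⟨hxA, hyB, he⟩, fun hzd => ?_⟩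
  rcases hD.triMeshBoundary_subset (bdry hzd hxz.symm fun h => hA h.symm) with hzA | hzB
  · exact hB (hD.adj_of_mem_arcs z hzA e.snd hyB hzy)
  · exact hA (hD.adj_of_mem_arcs e.fst hxA z hzB hxz)

/-- **A source of the step digraph is an outer `A`–`B` face.** If a face has an outgoing
exploration step and no incoming one, the crossed edge is an `A`–`B` edge of `Ω_δ` and the third
vertex is outside `Ω_δ`. [cite: Smirnov2001, long version §3 p. 11 before Theorem 3] -/
theorem mem_abFaces_of_source (hD : D.IsAdmissible) {ω : Percolation.SiteConfig (Site 2)}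
    {f g : HexVertex} (hfg : IsExplorationStep D ω f g) (hno : ∀ h, ¬ IsExplorationStep D ω h f) :
    f ∈ D.abFaces := by
  obtain ⟨e, he, hadj, hx, hy⟩ := hfg
  have hf : (triEdgeFaces e).2 = f := by rw [he]
  obtain ⟨j, hj, hj1⟩ := exists_eq_faceVertex_of_triEdgeFaces_snd hf
  -- `e = faceVertex f (j+1) → faceVertex f j`; the third vertex is `faceVertex f (j+2)`
  have hxz : triGraph.Adj e.fst (faceVertex f (j + 2)) := by
    rw [hj1, ← fin3_add_one_add_one]
    exact adj_faceVertex_succ f (j + 1)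
  have hzy : triGraph.Adj (faceVertex f (j + 2)) e.snd := by
    have h := adj_faceVertex_succ f (j + 2)
    rwa [fin3_add_two_add_one, ← hj] at h
  have H1 : ¬ ((triDiscreteDomainGraph D.Ω D.δ).Adj e.fst (faceVertex f (j + 2)) ∧
      faceVertex f (j + 2) ∉ D.bcConfig ω) := by
    rintro ⟨h1, h2⟩
    -- the dart `x → z` is the anticlockwise dart `j + 1` of `f`: an incoming step
    refine hno _ ⟨⟨(faceVertex f (j + 1), faceVertex f (j + 1 + 1)),
      adj_faceVertex_succ f (j + 1)⟩,
      Prod.ext (triEdgeFaces_fst_faceVertex f (j + 1)) rfl, ?_, ?_, ?_⟩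
    · show (triDiscreteDomainGraph D.Ω D.δ).Adj (faceVertex f (j + 1)) (faceVertex f (j + 1 + 1))
      rwa [fin3_add_one_add_one, ← hj1]
    · show faceVertex f (j + 1) ∈ D.bcConfig ω
      rwa [← hj1]
    · show faceVertex f (j + 1 + 1) ∉ D.bcConfig ω
      rwa [fin3_add_one_add_one]
  have H2 : ¬ ((triDiscreteDomainGraph D.Ω D.δ).Adj (faceVertex f (j + 2)) e.snd ∧
      faceVertex f (j + 2) ∈ D.bcConfig ω) := by
    rintro ⟨h1, h2⟩
    -- the dart `z → y` is the anticlockwise dart `j + 2` of `f`: an incoming step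
    refine hno _ ⟨⟨(faceVertex f (j + 2), faceVertex f (j + 2 + 1)),
      adj_faceVertex_succ f (j + 2)⟩,
      Prod.ext (triEdgeFaces_fst_faceVertex f (j + 2)) rfl, ?_, h2, ?_⟩
    · show (triDiscreteDomainGraph D.Ω D.δ).Adj (faceVertex f (j + 2)) (faceVertex f (j + 2 + 1))
      rwa [fin3_add_two_add_one, ← hj]
    · show faceVertex f (j + 2 + 1) ∉ D.bcConfig ω
      rwa [fin3_add_two_add_one, ← hj]
  obtain ⟨he', hzd⟩ := hD.mem_abDarts_of_blocked hadj hx hy hxz hzy H1 H2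
  exact ⟨e, he', Or.inr hf.symm, fun hsub => hzd (hsub (Finset.mem_coe.2 (faceVertex_mem f _)))⟩

/-- **A sink of the step digraph is an outer `A`–`B` face.** If a face has an incoming
exploration step and no outgoing one, the crossed edge is an `A`–`B` edge of `Ω_δ` and the third
vertex is outside `Ω_δ`. [cite: Smirnov2001, long version §3 p. 11 before Theorem 3] -/
theorem mem_abFaces_of_sink (hD : D.IsAdmissible) {ω : Percolation.SiteConfig (Site 2)}
    {f h : HexVertex} (hhf : IsExplorationStep D ω h f) (hno : ∀ g, ¬ IsExplorationStep D ω f g) :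
    f ∈ D.abFaces := by
  obtain ⟨e, he, hadj, hx, hy⟩ := hhf
  have hf : (triEdgeFaces e).1 = f := by rw [he]
  obtain ⟨j, hj, hj1⟩ := exists_eq_faceVertex_of_triEdgeFaces_fst hf
  -- `e = faceVertex f j → faceVertex f (j+1)`; the third vertex is `faceVertex f (j+2)`
  have hxz : triGraph.Adj e.fst (faceVertex f (j + 2)) := by
    have h := adj_faceVertex_succ f (j + 2)
    rw [fin3_add_two_add_one, ← hj] at h
    exact h.symm
  have hzy : triGraph.Adj (faceVertex f (j + 2)) e.snd := by
    have h := adj_faceVertex_succ f (j + 1)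
    rw [fin3_add_one_add_one, ← hj1] at h
    exact h.symm
  have H1 : ¬ ((triDiscreteDomainGraph D.Ω D.δ).Adj e.fst (faceVertex f (j + 2)) ∧
      faceVertex f (j + 2) ∉ D.bcConfig ω) := by
    rintro ⟨h1, h2⟩
    -- the dart `x → z` is the clockwise dart `faceVertex f (j+2+1) → faceVertex f (j+2)`
    refine hno _ ⟨⟨(faceVertex f (j + 2 + 1), faceVertex f (j + 2)),
      (adj_faceVertex_succ f (j + 2)).symm⟩,
      Prod.ext rfl (triEdgeFaces_snd_faceVertex f (j + 2)), ?_, ?_, h2⟩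
    · show (triDiscreteDomainGraph D.Ω D.δ).Adj (faceVertex f (j + 2 + 1)) (faceVertex f (j + 2))
      rwa [fin3_add_two_add_one, ← hj]
    · show faceVertex f (j + 2 + 1) ∈ D.bcConfig ω
      rwa [fin3_add_two_add_one, ← hj]
  have H2 : ¬ ((triDiscreteDomainGraph D.Ω D.δ).Adj (faceVertex f (j + 2)) e.snd ∧
      faceVertex f (j + 2) ∈ D.bcConfig ω) := by
    rintro ⟨h1, h2⟩
    -- the dart `z → y` is the clockwise dart `faceVertex f (j+1+1) → faceVertex f (j+1)`
    refine hno _ ⟨⟨(faceVertex f (j + 1 + 1), faceVertex f (j + 1)),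
      (adj_faceVertex_succ f (j + 1)).symm⟩,
      Prod.ext rfl (triEdgeFaces_snd_faceVertex f (j + 1)), ?_, ?_, ?_⟩
    · show (triDiscreteDomainGraph D.Ω D.δ).Adj (faceVertex f (j + 1 + 1)) (faceVertex f (j + 1))
      rwa [fin3_add_one_add_one, ← hj1]
    · show faceVertex f (j + 1 + 1) ∈ D.bcConfig ω
      rwa [fin3_add_one_add_one]
    · show faceVertex f (j + 1) ∉ D.bcConfig ω
      rwa [← hj1]
  obtain ⟨he', hzd⟩ := hD.mem_abDarts_of_blocked hadj hx hy hxz hzy H1 H2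
  exact ⟨e, he', Or.inl hf.symm, fun hsub => hzd (hsub (Finset.mem_coe.2 (faceVertex_mem f _)))⟩

/-- **An outer `A`–`B` face is a source or a sink of the step digraph**: the `A`–`B` dart gives
the step across it, and any other step at that face would cross an edge of `Ω_δ` containing the
third vertex, which lies outside `Ω_δ`. [cite: Smirnov2001, long version §3 p. 11 before Theorem 3] -/
theorem source_or_sink_of_mem_abFaces (hD : D.IsAdmissible) (ω : Percolation.SiteConfig (Site 2))
    {f : HexVertex} (hf : f ∈ D.abFaces) :
    ((∃ g, IsExplorationStep D ω f g) ∧ ∀ h, ¬ IsExplorationStep D ω h f) ∨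
      ((∃ h, IsExplorationStep D ω h f) ∧ ∀ g, ¬ IsExplorationStep D ω f g) := by
  obtain ⟨e, ⟨hxA, hyB, hadj⟩, hfe, hnot⟩ := hf
  have hx : e.fst ∈ D.bcConfig ω := D.mem_bcConfig_of_mem_triArcA hxA
  have hy : e.snd ∉ D.bcConfig ω := hD.notMem_bcConfig hyB
  have hxd : e.fst ∈ triMeshDomain D.Ω D.δ := (triDiscreteDomainGraph_adj_iff.1 hadj).2.1
  have hyd : e.snd ∈ triMeshDomain D.Ω D.δ := (triDiscreteDomainGraph_adj_iff.1 hadj).2.2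
  rcases hfe with hfe | hfe
  · -- `f` is the left face of the `A`–`B` dart: a sink
    right
    obtain ⟨j, hj, hj1⟩ := exists_eq_faceVertex_of_triEdgeFaces_fst hfe.symm
    refine ⟨⟨(triEdgeFaces e).2, e, Prod.ext hfe.symm rfl, hadj, hx, hy⟩, fun g hg => ?_⟩
    obtain ⟨e', he', hadj', hx', hy'⟩ := hg
    have hf' : (triEdgeFaces e').2 = f := by rw [he']
    obtain ⟨j', hj', hj1'⟩ := exists_eq_faceVertex_of_triEdgeFaces_snd hf'
    have hd1 : e'.fst ∈ triMeshDomain D.Ω D.δ := (triDiscreteDomainGraph_adj_iff.1 hadj').2.1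
    have hd2 : e'.snd ∈ triMeshDomain D.Ω D.δ := (triDiscreteDomainGraph_adj_iff.1 hadj').2.2
    rcases fin3_trichotomy j j' with rfl | rfl | rfl
    · rw [hj', ← hj] at hy'
      exact hy' hx
    · refine hnot (hexFaceVertices_subset_of_faceVertex_mem j ?_ ?_ ?_)
      · rwa [← hj]
      · rwa [← hj1]
      · rw [← fin3_add_one_add_one, ← hj1']; exact hd1
    · refine hnot (hexFaceVertices_subset_of_faceVertex_mem j ?_ ?_ ?_)
      · rwa [← hj]
      · rwa [← hj1]
      · rw [← hj']; exact hd2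
  · -- `f` is the right face of the `A`–`B` dart: a source
    left
    obtain ⟨j, hj, hj1⟩ := exists_eq_faceVertex_of_triEdgeFaces_snd hfe.symm
    refine ⟨⟨(triEdgeFaces e).1, e, Prod.ext rfl hfe.symm, hadj, hx, hy⟩, fun h hh => ?_⟩
    obtain ⟨e', he', hadj', hx', hy'⟩ := hh
    have hf' : (triEdgeFaces e').1 = f := by rw [he']
    obtain ⟨j', hj', hj1'⟩ := exists_eq_faceVertex_of_triEdgeFaces_fst hf'
    have hd1 : e'.fst ∈ triMeshDomain D.Ω D.δ := (triDiscreteDomainGraph_adj_iff.1 hadj').2.1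
    have hd2 : e'.snd ∈ triMeshDomain D.Ω D.δ := (triDiscreteDomainGraph_adj_iff.1 hadj').2.2
    rcases fin3_trichotomy j j' with rfl | rfl | rfl
    · rw [hj', ← hj] at hx'
      exact hy hx'
    · refine hnot (hexFaceVertices_subset_of_faceVertex_mem j ?_ ?_ ?_)
      · rwa [← hj]
      · rwa [← hj1]
      · rw [← fin3_add_one_add_one, ← hj1']; exact hd2
    · refine hnot (hexFaceVertices_subset_of_faceVertex_mem j ?_ ?_ ?_)
      · rwa [← hj]
      · rwa [← hj1]
      · rw [← hj']; exact hd1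

/-- The faces meeting `Ω_δ` (among which all faces with an exploration step) form a finite set,
`Ω_δ` being finite for a bounded domain and a positive mesh. [cite: Smirnov2001, long version §3 p. 11 before Theorem 3] -/
theorem finite_stepFaces (hD : D.IsAdmissible) :
    {f : HexVertex | ∃ x ∈ hexFaceVertices f, x ∈ triMeshDomain D.Ω D.δ}.Finite := by
  have hfin : (triMeshDomain D.Ω D.δ).Finite :=
    triMeshDomain_finite_holds hD.isBounded hD.delta_pos
  refine (hfin.biUnion fun x _ => (facesAt x).finite_toSet).subset ?_
  rintro f ⟨x, hxf, hxd⟩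
  exact Set.mem_biUnion hxd (Finset.mem_coe.2 (mem_facesAt.2 hxf))

end DiscreteDobrushin.IsAdmissible

/-! ### Existence and uniqueness of the exploration path -/

/-- **The exploration process is well defined** (`existsUnique_explorationPath` holds): for
admissible discrete Dobrushin data every site configuration has exactly one maximal exploration
path. Smirnov 2001 (long version), §3, p. 11: "For any percolation configuration there is a
unique curve `γ_e.p.` along the edges of the dual hexagonal lattice, which goes from `a` to `b`
separating the blue clusters intersecting the arc `ab` from the yellow clusters intersecting the
arc `ba`." See the module docstring for the proof. [cite: Smirnov2001, long version §3 p. 11 before Theorem 3] -/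
theorem existsUnique_explorationPath_holds : existsUnique_explorationPath := by
  intro D hD ω
  classical
  -- degree bounds of the step relation `S`
  have hout : ∀ ⦃a b c : HexVertex⦄, IsExplorationStep D ω a b → IsExplorationStep D ω a c →
      b = c := fun a b c h h' => IsExplorationStep.out_unique h h'
  have hin : ∀ ⦃a b c : HexVertex⦄, IsExplorationStep D ω a c → IsExplorationStep D ω b c →
      a = b := fun a b c h h' => IsExplorationStep.in_unique h h'
  have hSG : ∀ ⦃a b : HexVertex⦄, IsExplorationStep D ω a b → hexGraph.Adj a b :=
    fun a b h => IsExplorationStep.adj h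
  have hFfin := hD.finite_stepFaces
  -- a source exists
  obtain ⟨a, ⟨a₁, ha₁⟩, ha⟩ :
      ∃ a, (∃ g, IsExplorationStep D ω a g) ∧ ∀ h, ¬ IsExplorationStep D ω h a := by
    have hne : D.abFaces.Nonempty :=
      Set.nonempty_of_ncard_ne_zero (by rw [hD.ncard_abFaces_eq_two]; norm_num)
    obtain ⟨u, hu⟩ := hne
    rcases hD.source_or_sink_of_mem_abFaces ω hu with hsrc | ⟨⟨p, hp⟩, hno⟩
    · exact ⟨u, hsrc⟩
    · -- `u` is a sink: search backwards (`flip`ped steps, out-degree bound as in-degree bound)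
      obtain ⟨b, w, -, hSw, hend⟩ := exists_maximal_stepPath (G := hexGraph)
        (flip (IsExplorationStep D ω)) (fun a b h => (hSG h).symm) (fun a b c h h' => hout h h')
        hFfin (fun a b h => (IsExplorationStep.mem_stepFaces h).1) (a := u) (a₁ := p)
        (fun c hc => hno c hc) hp
      have hbu : b ≠ u := by
        rintro rfl
        exact hend p hp
      have hbt : b ∈ w.support.tail := by
        have h := w.end_mem_support
        rw [← w.cons_tail_support, List.mem_cons] at h
        exact h.resolve_left hbu
      rw [← Walk.map_snd_darts] at hbt
      obtain ⟨d, hd, hdb⟩ := List.mem_map.1 hbt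
      refine ⟨b, ⟨d.fst, ?_⟩, fun c hc => hend c hc⟩
      have h := hSw d hd
      rw [hdb] at h
      exact h
  -- existence: the longest step-path from the source `a`
  obtain ⟨b, w, hw, hSw, hend⟩ := exists_maximal_stepPath (G := hexGraph)
    (IsExplorationStep D ω) hSG hin hFfin (fun a b h => (IsExplorationStep.mem_stepFaces h).2)
    ha ha₁
  have hab : a ≠ b := by
    rintro rfl
    exact hend a₁ ha₁
  have hpath : IsExplorationPath D ω w :=
    { isPath := hw
      ne := hab
      step := hSw
      not_step_start := ha
      not_step_end := hend }
  refine ⟨⟨a, b, w⟩, hpath, ?_⟩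
  -- uniqueness
  rintro ⟨a', b', w'⟩ h'
  dsimp only at h'
  -- starts are sources, ends are sinks: all outer `A`–`B` faces, of which there are two
  obtain ⟨v', hav', q', hq'⟩ := w'.exists_eq_cons_of_ne h'.ne
  have ha'v' : IsExplorationStep D ω a' v' :=
    h'.step ⟨(a', v'), hav'⟩ (by rw [hq']; simp)
  have ha'F : a' ∈ D.abFaces := hD.mem_abFaces_of_source ha'v' h'.not_step_start
  have haF : a ∈ D.abFaces := hD.mem_abFaces_of_source ha₁ ha
  have hbF : b ∈ D.abFaces := by
    have hbt : b ∈ w.support.tail := by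
      have h := w.end_mem_support
      rw [← w.cons_tail_support, List.mem_cons] at h
      exact h.resolve_left (Ne.symm hab)
    rw [← Walk.map_snd_darts] at hbt
    obtain ⟨d, hd, hdb⟩ := List.mem_map.1 hbt
    have hdS : IsExplorationStep D ω d.fst b := by rw [← hdb]; exact hSw d hd
    exact hD.mem_abFaces_of_sink hdS hend
  have hpair : ({a, b} : Set HexVertex) = D.abFaces :=
    Set.eq_of_subset_of_ncard_le (Set.insert_subset_iff.2 ⟨haF, Set.singleton_subset_iff.2 hbF⟩)
      (le_of_eq (by rw [hD.ncard_abFaces_eq_two, Set.ncard_pair hab]))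
      (Set.finite_of_ncard_ne_zero (by rw [hD.ncard_abFaces_eq_two]; norm_num))
  rw [← hpair] at ha'F
  rcases ha'F with rfl | rfl
  · -- same start: determinism
    have key := stepPath_unique (G := hexGraph) (IsExplorationStep D ω) hout w' w h'.step hSw
      h'.not_step_end hend
    obtain ⟨rfl, hww⟩ := Sigma.mk.inj_iff.1 key
    have hww' := eq_of_heq hww
    subst hww'
    rfl
  · exact (hend v' ha'v').elim

/-- **For admissible data the exploration walk is defined** (`explorationWalk_isSome` holds).
[cite: Smirnov2001, long version §3 p. 11 before Theorem 3] -/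
theorem explorationWalk_isSome_holds : explorationWalk_isSome := by
  intro D hD ω
  unfold explorationWalk
  rw [dif_pos (existsUnique_explorationPath_holds D hD ω)]
  rfl

end

end Literature.Probability.LatticeModels
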